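import Mathlib
import Literature.Analysis.FluidPDE.ClassicalSolution
import Literature.Analysis.FluidPDE.LerayHopf
import Literature.Analysis.FluidPDE.SuitableWeak
import Summits.NavierStokesRegularity.NavierStokesRegularity.Theses.L3TimeExponentPincer
import Summits.NavierStokesRegularity.NavierStokesRegularity.Theorems.L3TimeExponentPincerEffNode
import Summits.NavierStokesRegularity.NavierStokesRegularity.Theorems.L3TimeExponentPincerEffSatBlowupTypeIRung
import HarnessLib.Audit
import HarnessLib

/-!
# Placement of the RESIDUAL crux `SupercriticalSerrinL3` (route `L3TimeExponentPincer`) against the hard cores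

Support file for `stmt-NavierStokesRegularity-19500` (`SupercriticalSerrinL3`, the route's DECLARED RESIDUAL conjunct;
cell ns-regularity-ideate, seat p4).  Two kernel-checked placements, both one-liners over landed tree theorems:

* `noTypeIBlowup_of_supercriticalSerrinL3` — **the residual crux implies the hard core `NoTypeIBlowup`**
  (`…Theses.TypeICertificateLadder.NoTypeIBlowup` = `stmt-NavierStokesRegularity-1217`, "no Type-I blow-up for Clay
  data"): a frame Type-I BLOW-UP would satisfy `K₃(1)` (`effSaturatesAt_of_typeI_blowup`, the Type-I rung of the child
  crux) hence the jaw `∫_{T₂}^T ‖u‖₃^q < ∞` at the partner's exponent `q < 5 = q(1)` (`jaw_of_effSaturatesAt`), so the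
  supercritical Serrin partner extends it — contradiction.  (Equally: the route's BC5 rung
  `Theorems.L3TimeExponentPincerTypeIRung.L3CascadeJaw_rung`, `L³` rate `1/6`.)  This is the planner's "why it might fail: it contains Type-I exclusion" as a
  theorem — the kernel certificate that the conjunct is residual (tribunal t1r).
* `navierStokesRegularity_of_noTypeII_of_supercriticalSerrinL3` — **given the hard core `NoTypeII` (`stmt-0056`), the
  route reduces to its residual**: `NoTypeII → SupercriticalSerrinL3 → NavierStokesRegularity`: a frame solution that
  failed to extend would be maximal, hence Type I (`NoTypeII`), hence would extend (previous bullet) — so there is no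
  blow-up, and the tree theorem `navierStokesRegularity_of_noBlowup` (shared support `NoBlowupToClay`, stmt-0055) gives
  (A).  (The same follows from `Theorems.L3TimeExponentPincerEffSatTypeIRung.l3CascadeJaw_of_noTypeII` and the route's
  deciding theorem `closes`.)

So the route's logical geography is: `NoTypeII (0056) ⟹ EffSatBlowup (19139) ⟹ L3CascadeJaw (19499)` and
`SupercriticalSerrinL3 (19500) ⟹ NoTypeIBlowup (1217)`; the two hard cores `0056 ∧ 1217` give Clay (A) already
(route `TypeICertificateLadder`), and so does `0056 ∧ 19500`.

WHAT THIS IS NOT: not a claim about Navier–Stokes regularity — implications between open typed statements; no item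
is closed by this file.
-/

namespace Summit.NavierStokesRegularity.NavierStokesRegularity.Theorems.L3TimeExponentPincerSerrinBridges

open MeasureTheory Set
open Literature.Analysis.FluidPDE
open Summit.NavierStokesRegularity.NavierStokesRegularity.Theorems.L3TimeExponentPincerEffNode
open Summit.NavierStokesRegularity.NavierStokesRegularity.Theorems.L3TimeExponentPincerEffSatTypeIRung

/-- **The residual crux contains Type-I exclusion**: `SupercriticalSerrinL3` (stmt-19500) ⇒ `NoTypeIBlowup`
(stmt-1217, hard core).  Proof: the Type-I rung `L3CascadeJaw_rung` supplies the window integrability at the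
partner's exponent `q < 5 < 6`. -/
theorem noTypeIBlowup_of_supercriticalSerrinL3
    (h : Summit.NavierStokesRegularity.NavierStokesRegularity.Theses.L3TimeExponentPincer.SupercriticalSerrinL3) :
    Summit.NavierStokesRegularity.NavierStokesRegularity.Theses.TypeICertificateLadder.NoTypeIBlowup := by
  obtain ⟨q, hq4, hq5, hK⟩ := h
  intro ν T hν hT u p hcl hLH hdec hTI
  by_contra hmax
  -- a Type-I blow-up is `K₃(1)` (Type-I rung of the child crux), hence has the jaw at `q < 5 = q(1)` …
  have hK₃ : EffSaturatesAt 1 u T := effSaturatesAt_of_typeI_blowup hν hT hcl hLH hdec hTI hmax 1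
  have hjaw := jaw_of_effSaturatesAt (σ := 1) (by norm_num) hν hT hLH hK₃ (q := q) (by linarith)
    (by rw [qOfSigma_one]; exact hq5)
  -- … so the supercritical Serrin partner extends it: contradiction.
  exact hmax (hK ν T hν hT u p hcl hLH hdec hjaw)

/-- **Modulo the hard core `NoTypeII` the route is its residual**: `NoTypeII` (stmt-0056) and
`SupercriticalSerrinL3` (stmt-19500) give Fefferman's (A): a non-extending frame solution is maximal, hence Type I,
hence extends by `noTypeIBlowup_of_supercriticalSerrinL3` — contradiction; then `navierStokesRegularity_of_noBlowup`. -/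
theorem navierStokesRegularity_of_noTypeII_of_supercriticalSerrinL3
    (h₁ : Summit.NavierStokesRegularity.NavierStokesRegularity.Theses.TypeICertificateLadder.NoTypeII)
    (h₂ : Summit.NavierStokesRegularity.NavierStokesRegularity.Theses.L3TimeExponentPincer.SupercriticalSerrinL3) :
    NavierStokesRegularity :=
  navierStokesRegularity_of_noBlowup fun ν T hν hT u p hcl hLH hdec => by
    by_contra hne
    exact hne (noTypeIBlowup_of_supercriticalSerrinL3 h₂ ν T hν hT u p hcl hLH hdec
      (h₁ ν T hν hT u p ⟨hcl, hne⟩ hLH hdec))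

end Summit.NavierStokesRegularity.NavierStokesRegularity.Theorems.L3TimeExponentPincerSerrinBridges
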